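/-
Copyright: statement-level skeleton of a published paper (lit-balaban cell, reader/typer r15; Phase-2 seat p09 taken by the
nominating reader). No proof claims beyond what the kernel checks below.
-/
import Mathlib

/-!
# BIJ85 — T. Bałaban, J. Imbrie, A. Jaffe, *Renormalization of the Higgs model: minimizers, propagators and the
stability of mean field theory*, CMP **97** (1985) 299–329, Sect. 7.1: the inequality (7.1.20)

statement-level skeleton of published theorems with citation tags; proofs where landed; nothing here is a claim about
the Yang–Mills mass gap

Source: held text `paper:balaban1985-cmp97-bij-higgs-minimizers`; render of p. 323 [PDF 25] read as an image
(`pub-balaban/t4/b2b-balaban-t4-lit2/renders/bij1985/1985-cmp97-bij-higgs-minimizers-p025-x2.png`).  Row C1.Eq7.1.13-7.1.20 of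
`HOME/lit-balaban-r15/ROWS-C1.md`; Phase-2 envelope seat p09 (PHASE2-TARGETS.md §G.3, "the (7.1.20) sine inequality used in
Prop. 7.1.2").

p. 323, verbatim: *"In fact |v_μ(p)| = [sin(p_μ/2)/(p_μ/2)]·[(p_μη/2)/sin(p_μη/2)], and since for |x| ≤ π/2, 2/π ≤ sin x/x ≤ 1,
it follows that for |p_i| ≤ π, 2/π ≤ |v_μ(p)| ≤ π/2. (7.1.20)"* (η = L^{−k} ∈ (0, 1]).

Typed reading: `sincR x = sin x/x` (x ≠ 0); the printed modulus |v_μ(p)| is the quotient `sincR (p/2) / sincR (pη/2)` of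
the two bracketed factors (both positive for 0 < |p| ≤ π, 0 < η ≤ 1 — `sincR_pos`); PROVED: the elementary bound
2/π ≤ sin x/x ≤ 1 for 0 < |x| ≤ π/2 (`sincR_bounds`, Mathlib's Jordan inequality `Real.mul_le_sin` and `Real.sin_le`) and
(7.1.20) itself (`ineq7120`).  At p = 0 the printed quotient is 1 by continuity and (7.1.20) is trivial; typed for p ≠ 0.
-/

namespace Literature.MathematicalPhysics.QuantumFieldTheory.BalabanImbrieJaffe1984to88.BIJ85Eq7120

open Real

/-- sin x / x (the bracketed factors of |v_μ(p)|, p. 323). [cite: BalabanImbrieJaffe1985, (7.1.20) p.323] -/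
noncomputable def sincR (x : ℝ) : ℝ := Real.sin x / x

/-- sin x / x is even. [cite: BalabanImbrieJaffe1985, (7.1.20) p.323] -/
theorem sincR_neg (x : ℝ) : sincR (-x) = sincR x := by
  unfold sincR
  rw [Real.sin_neg, neg_div_neg_eq]

/-- sin x / x = sin |x| / |x|. [cite: BalabanImbrieJaffe1985, (7.1.20) p.323] -/
theorem sincR_abs (x : ℝ) : sincR |x| = sincR x := by
  rcases le_or_gt 0 x with h | h
  · rw [abs_of_nonneg h]
  · rw [abs_of_neg h, sincR_neg]

/-- p. 323 [PDF 25], verbatim: *"since for |x| ≤ π/2, 2/π ≤ sin x/x ≤ 1"* — PROVED for 0 < |x| ≤ π/2 (Jordan's inequality).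
[cite: BalabanImbrieJaffe1985, (7.1.20) p.323] -/
theorem sincR_bounds {x : ℝ} (hx0 : x ≠ 0) (hx : |x| ≤ π / 2) : 2 / π ≤ sincR x ∧ sincR x ≤ 1 := by
  rw [← sincR_abs]
  have hy0 : 0 < |x| := abs_pos.mpr hx0
  set y := |x| with hy
  unfold sincR
  constructor
  · rw [le_div_iff₀ hy0]
    exact Real.mul_le_sin hy0.le hx
  · rw [div_le_one hy0]
    exact Real.sin_le hy0.le

/-- Positivity of sin x / x for 0 < |x| ≤ π/2. [cite: BalabanImbrieJaffe1985, (7.1.20) p.323] -/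
theorem sincR_pos {x : ℝ} (hx0 : x ≠ 0) (hx : |x| ≤ π / 2) : 0 < sincR x :=
  lt_of_lt_of_le (by positivity) (sincR_bounds hx0 hx).1

/-- The printed modulus *"|v_μ(p)| = [sin(p_μ/2)/(p_μ/2)]·[(p_μη/2)/sin(p_μη/2)]"* as the quotient of the two bracketed
factors. [cite: BalabanImbrieJaffe1985, (7.1.20) p.323] -/
noncomputable def vAbs (η p : ℝ) : ℝ := sincR (p / 2) / sincR (p * η / 2)

/-- **(7.1.20)** p. 323 [PDF 25], verbatim: *"it follows that for |p_i| ≤ π, 2/π ≤ |v_μ(p)| ≤ π/2. (7.1.20)"* — PROVED for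
0 < |p| ≤ π and 0 < η ≤ 1 (η = L^{−k}). [cite: BalabanImbrieJaffe1985, (7.1.20) p.323] -/
theorem ineq7120 {η p : ℝ} (hη0 : 0 < η) (hη1 : η ≤ 1) (hp0 : p ≠ 0) (hp : |p| ≤ π) :
    2 / π ≤ vAbs η p ∧ vAbs η p ≤ π / 2 := by
  have ha0 : p / 2 ≠ 0 := by positivity
  have ha : |p / 2| ≤ π / 2 := by rw [abs_div, abs_two]; linarith
  have hb0 : p * η / 2 ≠ 0 := by positivity
  have hb : |p * η / 2| ≤ π / 2 := by
    rw [abs_div, abs_mul, abs_two, abs_of_pos hη0]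
    have : |p| * η ≤ |p| * 1 := mul_le_mul_of_nonneg_left hη1 (abs_nonneg p)
    linarith
  obtain ⟨hA1, hA2⟩ := sincR_bounds ha0 ha
  obtain ⟨hB1, hB2⟩ := sincR_bounds hb0 hb
  have hApos : 0 < sincR (p / 2) := sincR_pos ha0 ha
  have hBpos : 0 < sincR (p * η / 2) := sincR_pos hb0 hb
  have hπ : 0 < π := Real.pi_pos
  unfold vAbs
  constructor
  · -- A/B ≥ A ≥ 2/π since B ≤ 1
    calc 2 / π ≤ sincR (p / 2) := hA1
      _ = sincR (p / 2) / 1 := (div_one _).symm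
      _ ≤ sincR (p / 2) / sincR (p * η / 2) := div_le_div_of_nonneg_left hApos.le hBpos hB2
  · -- A/B ≤ 1/B ≤ π/2 since A ≤ 1 and B ≥ 2/π
    calc sincR (p / 2) / sincR (p * η / 2) ≤ 1 / sincR (p * η / 2) :=
          div_le_div_of_nonneg_right hA2 hBpos.le
      _ ≤ 1 / (2 / π) := div_le_div_of_nonneg_left zero_le_one (by positivity) hB1
      _ = π / 2 := by field_simp

end Literature.MathematicalPhysics.QuantumFieldTheory.BalabanImbrieJaffe1984to88.BIJ85Eq7120
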